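import Summits.Schanuel.Schanuel.Theorems.RootDecomp1ELWTransport02

/-!
# RootDecomp1ELWTransport — lens 2, generation 39 «LW-PAIR NORM TRANSPORT CELL» (lane E-R18 (a)): S ITSELF on the class `InLWClass` (E-doubled moment curves over a dyadic 2-fold-hyper-Liouville T), engine `algebraicIndependent_lwPt` mod `hLW : LWMeasure` — continuation (RootDecomp1ELWTransport03): §2 the collapse `P(T, e^{T^j}, e^{βT^j}) ↦ A(u,v)` at a dyadic approximant: `lwPt`, blocks, `Apoly`, `Apoly_ne_zero`, `FL`

(lens-2 g39 `LWTransport.lean` [HOME/decomp-schanuel-lens-2/g39/ sha256 cff5d88d…e8f0, 2208 l; NODE L1907 / REQUEST L1908; critic VERDICT L1909 (CLEARED, E-R18 (a) cell credit, port GO)]; port by census-1 gen 17 as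
`RootDecomp1ELWTransport01`–`09` — see the PORT NOTE of part 01; `--supports stmt-Schanuel-31409`; rung 0.)
-/

noncomputable section

open Complex Polynomial
open Literature.NumberTheory.Transcendental (zlen zlen_nonneg zlen_add_le zlen_monomial_le zlen_sum_le
  zlen_mul_le zlen_pow_le)

namespace Summit.Schanuel.Schanuel.Theorems.RootDecomp1ELWTransport

/-! ## §2  The collapse `P(T, e^{T^j}, e^{βT^j}) ↦ A(u, v) ∈ ℤ[u, v]` at a dyadic approximant

Coordinates: index type `Fin (k + k + 1)`; slot `0` carries `x`, slots `succ (castAdd k j)` carry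
`e^{x^{j+1}}` and slots `succ (natAdd k j)` carry `e^{β x^{j+1}}` (`j : Fin k`).  At `x = p/q`,
`Q = q^k`, `u = e^{1/Q}`, `v = e^{β/Q}`: `e^{(p/q)^{j+1}} = u^{E_j}`, `e^{β(p/q)^{j+1}} = v^{E_j}` with the
HyperCell weights `E_j = Ewt k q p j = p^{j+1} q^{k-j-1}`. -/

open Summit.Schanuel.Schanuel.Theorems.RootDecomp1KHyper (SB SFset sb_of_algebraicIndependent LWMeasure
  exists_ball_eval_ne_zero exists_int_mul_eq_map mvaeval_int_map)
open Summit.Schanuel.Schanuel.Theorems.RootDecomp1KHyper.HyperCell (Ewt exC collPoly collPoly_ne_zero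
  exC_inj)
open NormDescent (P2)

variable {k : ℕ}

/-- the point `(x, e^{x}, …, e^{x^k}, e^{βx}, …, e^{βx^k})` -/
def lwPt (k : ℕ) (β x : ℂ) : Fin (k + k + 1) → ℂ :=
  Fin.cons x (Fin.append (fun j : Fin k => cexp (x ^ ((j : ℕ) + 1)))
    (fun j : Fin k => cexp (β * x ^ ((j : ℕ) + 1))))

/-- `lwPt k β x 0 = x` (for `(β x : ℂ)`). -/
@[simp] theorem lwPt_zero (β x : ℂ) : lwPt k β x 0 = x := by simp [lwPt]

/-- `lwPt k β x (Fin.succ (Fin.castAdd k j)) = cexp (x ^ ((j : ℕ) + 1))` (for `(β x : ℂ) (j : Fin k)`). -/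
@[simp] theorem lwPt_Y (β x : ℂ) (j : Fin k) :
    lwPt k β x (Fin.succ (Fin.castAdd k j)) = cexp (x ^ ((j : ℕ) + 1)) := by
  unfold lwPt
  rw [Fin.cons_succ, Fin.append_left]

/-- `lwPt k β x (Fin.succ (Fin.natAdd k j)) = cexp (β * x ^ ((j : ℕ) + 1))` (for `(β x : ℂ) (j : Fin k)`). -/
@[simp] theorem lwPt_E (β x : ℂ) (j : Fin k) :
    lwPt k β x (Fin.succ (Fin.natAdd k j)) = cexp (β * x ^ ((j : ℕ) + 1)) := by
  unfold lwPt
  rw [Fin.cons_succ, Fin.append_right]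

/-- the `Y`-block of a monomial -/
def blkY (s : Fin (k + k + 1) →₀ ℕ) : Fin k → ℕ := fun j => s (Fin.succ (Fin.castAdd k j))
/-- the `E`-block (β-direction) of a monomial -/
def blkE (s : Fin (k + k + 1) →₀ ℕ) : Fin k → ℕ := fun j => s (Fin.succ (Fin.natAdd k j))

/-- the collapsed weight `Σ_j a_j E_j` of a block -/
def wt (k q p : ℕ) (a : Fin k → ℕ) : ℕ := ∑ j : Fin k, a j * Ewt k q p j

/-- `s = t`. -/
theorem eq_of_blocks {s t : Fin (k + k + 1) →₀ ℕ} (h0 : s 0 = t 0) (hY : blkY s = blkY t)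
    (hE : blkE s = blkE t) : s = t := by
  ext i
  refine Fin.cases ?_ (fun i' => ?_) i
  · exact h0
  · refine Fin.addCases (fun j => ?_) (fun j => ?_) i'
    · exact congrFun hY j
    · exact congrFun hE j

/-- `(s.sum fun _ e => e) = s 0 + (∑ j, blkY s j + ∑ j, blkE s j)` (for `(s : Fin (k + k + 1) →₀ ℕ)`). -/
theorem sum_eq_blocks (s : Fin (k + k + 1) →₀ ℕ) :
    (s.sum fun _ e => e) = s 0 + (∑ j, blkY s j + ∑ j, blkE s j) := by
  rw [Finsupp.sum_fintype _ _ (fun _ => rfl), Fin.sum_univ_succ, Fin.sum_univ_add]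
  rfl

/-- `s 0 + (∑ j, blkY s j + ∑ j, blkE s j) ≤ P.totalDegree`. -/
theorem blocks_le_totalDegree {P : MvPolynomial (Fin (k + k + 1)) ℤ} {s : Fin (k + k + 1) →₀ ℕ}
    (hs : s ∈ P.support) :
    s 0 + (∑ j, blkY s j + ∑ j, blkE s j) ≤ P.totalDegree := by
  rw [← sum_eq_blocks]; exact MvPolynomial.le_totalDegree hs

/-- `Ewt k q p j ≤ (p + q) ^ k` (for `(k q p : ℕ) (j : Fin k)`). -/
theorem Ewt_le (k q p : ℕ) (j : Fin k) : Ewt k q p j ≤ (p + q) ^ k := by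
  unfold Ewt
  have hj : (j : ℕ) + 1 ≤ k := j.2
  calc p ^ ((j : ℕ) + 1) * q ^ (k - ((j : ℕ) + 1))
      ≤ (p + q) ^ ((j : ℕ) + 1) * (p + q) ^ (k - ((j : ℕ) + 1)) :=
        Nat.mul_le_mul (Nat.pow_le_pow_left (by omega) _) (Nat.pow_le_pow_left (by omega) _)
    _ = (p + q) ^ k := by rw [← pow_add, Nat.add_sub_cancel' hj]

/-- `wt k q p a ≤ (∑ j, a j) * (p + q) ^ k` (for `(k q p : ℕ) (a : Fin k → ℕ)`). -/
theorem wt_le (k q p : ℕ) (a : Fin k → ℕ) : wt k q p a ≤ (∑ j, a j) * (p + q) ^ k := by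
  unfold wt
  rw [Finset.sum_mul]
  exact Finset.sum_le_sum fun j _ => Nat.mul_le_mul_left _ (Ewt_le k q p j)

/-- `Ewt` as a complex number: `E_j = (p/q)^{j+1} q^k` -/
theorem Ewt_cast' {q : ℕ} (hq : q ≠ 0) (p : ℕ) (j : Fin k) :
    ((Ewt k q p j : ℕ) : ℂ) = ((p : ℂ) / q) ^ ((j : ℕ) + 1) * (q : ℂ) ^ k := by
  have hj : (j : ℕ) + 1 ≤ k := j.2
  have hqC : (q : ℂ) ≠ 0 := by exact_mod_cast hq
  unfold Ewt
  push_cast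
  rw [show (q : ℂ) ^ k = (q : ℂ) ^ ((j : ℕ) + 1) * (q : ℂ) ^ (k - ((j : ℕ) + 1)) by
    rw [← pow_add, Nat.add_sub_cancel' hj], div_pow]
  field_simp

/-- no collisions between blocks: from `exC_inj` -/
theorem wt_inj {d q p : ℕ} (hq : q ≠ 0) (hx : (collPoly k d).eval ((p : ℂ) / q) ≠ 0)
    {a a' : Fin k → ℕ} (ha : ∀ j, a j ≤ d) (ha' : ∀ j, a' j ≤ d)
    (h : wt k q p a = wt k q p a') : a = a' := by
  set s : Fin (k + 1) →₀ ℕ := Finsupp.equivFunOnFinite.symm (Fin.cons 0 a) with hs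
  set s' : Fin (k + 1) →₀ ℕ := Finsupp.equivFunOnFinite.symm (Fin.cons 0 a') with hs'
  have hsa : ∀ j : Fin k, s j.succ = a j := fun j => by simp [hs]
  have hsa' : ∀ j : Fin k, s' j.succ = a' j := fun j => by simp [hs']
  have hex : exC k q p s = exC k q p s' := by
    unfold exC; simp_rw [hsa, hsa']; exact h
  have := exC_inj hq hx (fun j => (hsa j).symm ▸ ha j) (fun j => (hsa' j).symm ▸ ha' j) hex
  funext j
  rw [← hsa j, ← hsa' j]; exact this j

/-- two-variable exponent -/
def fs2 (a b : ℕ) : Fin 2 →₀ ℕ := Finsupp.single 0 a + Finsupp.single 1 b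

/-- `fs2 a b 0 = a` (for `(a b : ℕ)`). -/
@[simp] theorem fs2_zero (a b : ℕ) : fs2 a b 0 = a := by simp [fs2]
/-- `fs2 a b 1 = b` (for `(a b : ℕ)`). -/
@[simp] theorem fs2_one (a b : ℕ) : fs2 a b 1 = b := by simp [fs2]

/-- `a = a' ∧ b = b'` (for `{a b a' b' : ℕ} (h : fs2 a b = fs2 a' b')`). -/
theorem fs2_inj {a b a' b' : ℕ} (h : fs2 a b = fs2 a' b') : a = a' ∧ b = b' := by
  constructor
  · have := DFunLike.congr_fun h 0; simpa using this
  · have := DFunLike.congr_fun h 1; simpa using this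

/-- the key of a monomial `s`: the pair of collapsed weights -/
def key (k q p : ℕ) (s : Fin (k + k + 1) →₀ ℕ) : Fin 2 →₀ ℕ := fs2 (wt k q p (blkY s)) (wt k q p (blkE s))

/-- the integer coefficient `coeff(s) p^{s 0} q^{d − s 0}` -/
def cf (P : MvPolynomial (Fin (k + k + 1)) ℤ) (d p q : ℕ) (s : Fin (k + k + 1) →₀ ℕ) : ℤ :=
  P.coeff s * (p : ℤ) ^ (s 0) * (q : ℤ) ^ (d - s 0)

/-- **the collapsed polynomial** `A(U, V) = q^d · P(p/q, U^{E_1}, …, U^{E_k}, V^{E_1}, …, V^{E_k})` -/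
def Apoly (P : MvPolynomial (Fin (k + k + 1)) ℤ) (d p q : ℕ) : P2 :=
  ∑ s ∈ P.support, MvPolynomial.monomial (key k q p s) (cf P d p q s)

/-- `∏ j, cexp (z j) ^ a j = cexp (∑ j, (a j : ℂ) * z j)` (for `(a : Fin k → ℕ) (z : Fin k → ℂ)`). -/
private theorem prod_pow_cexp (a : Fin k → ℕ) (z : Fin k → ℂ) :
    ∏ j, cexp (z j) ^ a j = cexp (∑ j, (a j : ℂ) * z j) := by
  rw [Complex.exp_sum]
  exact Finset.prod_congr rfl fun j _ => by rw [← Complex.exp_nat_mul]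

/-- `∏ i, lwPt k β x i ^ s i = x ^ (s 0) * ((∏ j : Fin k, cexp (x ^ ((j : ℕ) + 1)) ^ blkY s j) * ∏ j : Fin k, cexp (β * x ^ ((j : ℕ) + 1)) ^ blkE s j)` (for `(β x : ℂ) (s : Fin (k + k + 1) →₀ ℕ)`). -/
theorem prod_lwPt_pow (β x : ℂ) (s : Fin (k + k + 1) →₀ ℕ) :
    ∏ i, lwPt k β x i ^ s i =
      x ^ (s 0) * ((∏ j : Fin k, cexp (x ^ ((j : ℕ) + 1)) ^ blkY s j) *
        ∏ j : Fin k, cexp (β * x ^ ((j : ℕ) + 1)) ^ blkE s j) := by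
  rw [Fin.prod_univ_succ, Fin.prod_univ_add]
  simp only [lwPt_zero, lwPt_Y, lwPt_E]
  rfl

/-- evaluation of `P` at `lwPt` as an explicit sum -/
theorem aeval_lwPt_eq (P : MvPolynomial (Fin (k + k + 1)) ℤ) (β x : ℂ) :
    MvPolynomial.aeval (lwPt k β x) P =
      ∑ s ∈ P.support, ((P.coeff s : ℤ) : ℂ) * (x ^ (s 0) *
        ((∏ j : Fin k, cexp (x ^ ((j : ℕ) + 1)) ^ blkY s j) *
          ∏ j : Fin k, cexp (β * x ^ ((j : ℕ) + 1)) ^ blkE s j)) := by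
  rw [MvPolynomial.aeval_def, MvPolynomial.eval₂_eq']
  refine Finset.sum_congr rfl fun s _ => ?_
  rw [algebraMap_int_eq, eq_intCast, prod_lwPt_pow]

/-- (E1) the collapse identity: `A(u, v) = q^d P(lwPt(p/q))` for `u = e^{1/q^k}`, `v = e^{β/q^k}`. -/
theorem aeval_Apoly (P : MvPolynomial (Fin (k + k + 1)) ℤ) {d p q : ℕ}
    (hd : ∀ s ∈ P.support, s 0 ≤ d) (hq : q ≠ 0) (β : ℂ) :
    MvPolynomial.aeval ![cexp (((q : ℂ) ^ k)⁻¹), cexp (β * ((q : ℂ) ^ k)⁻¹)] (Apoly P d p q) =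
      (q : ℂ) ^ d * MvPolynomial.aeval (lwPt k β ((p : ℂ) / q)) P := by
  have hqC : (q : ℂ) ≠ 0 := by exact_mod_cast hq
  have hQ : (q : ℂ) ^ k ≠ 0 := pow_ne_zero _ hqC
  unfold Apoly
  rw [map_sum, aeval_lwPt_eq, Finset.mul_sum]
  refine Finset.sum_congr rfl fun s hs => ?_
  rw [MvPolynomial.aeval_monomial, algebraMap_int_eq, eq_intCast,
    Finsupp.prod_fintype _ _ (fun i => by simp), Fin.prod_univ_two]
  simp only [key, fs2_zero, fs2_one, Matrix.cons_val_zero, Matrix.cons_val_one]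
  -- the two blocks
  have hU : cexp (((q : ℂ) ^ k)⁻¹) ^ wt k q p (blkY s) =
      ∏ j : Fin k, cexp (((p : ℂ) / q) ^ ((j : ℕ) + 1)) ^ blkY s j := by
    unfold wt
    rw [← Finset.prod_pow_eq_pow_sum]
    refine Finset.prod_congr rfl fun j _ => ?_
    rw [mul_comm (blkY s j) (Ewt k q p j), pow_mul,
      ← Complex.exp_nat_mul (((q : ℂ) ^ k)⁻¹) (Ewt k q p j), Ewt_cast' hq]
    congr 2
    field_simp
  have hV : cexp (β * ((q : ℂ) ^ k)⁻¹) ^ wt k q p (blkE s) =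
      ∏ j : Fin k, cexp (β * ((p : ℂ) / q) ^ ((j : ℕ) + 1)) ^ blkE s j := by
    unfold wt
    rw [← Finset.prod_pow_eq_pow_sum]
    refine Finset.prod_congr rfl fun j _ => ?_
    rw [mul_comm (blkE s j) (Ewt k q p j), pow_mul,
      ← Complex.exp_nat_mul (β * ((q : ℂ) ^ k)⁻¹) (Ewt k q p j), Ewt_cast' hq]
    congr 2
    field_simp
  rw [hU, hV]
  have hs0 : s 0 ≤ d := hd s hs
  have hsplit : (q : ℂ) ^ d = (q : ℂ) ^ (s 0) * (q : ℂ) ^ (d - s 0) := by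
    rw [← pow_add, Nat.add_sub_cancel' hs0]
  simp only [cf, Int.cast_mul, Int.cast_pow, Int.cast_natCast]
  rw [hsplit, div_pow]
  field_simp

/-- (E3a) degree of the collapsed polynomial -/
theorem totalDegree_Apoly_le (P : MvPolynomial (Fin (k + k + 1)) ℤ) (d p q : ℕ) :
    (Apoly P d p q).totalDegree ≤ P.totalDegree * (p + q) ^ k := by
  unfold Apoly
  refine (MvPolynomial.totalDegree_finsetSum _ _).trans (Finset.sup_le fun s hs => ?_)
  refine (MvPolynomial.totalDegree_monomial_le _ _).trans ?_
  have h1 : ((key k q p s).sum fun _ => id) = wt k q p (blkY s) + wt k q p (blkE s) := by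
    rw [Finsupp.sum_fintype _ _ (fun _ => rfl), Fin.sum_univ_two]
    simp only [key, fs2_zero, fs2_one, id]
  rw [h1]
  have h2 := blocks_le_totalDegree hs
  calc wt k q p (blkY s) + wt k q p (blkE s)
      ≤ (∑ j, blkY s j) * (p + q) ^ k + (∑ j, blkE s j) * (p + q) ^ k :=
        Nat.add_le_add (wt_le k q p _) (wt_le k q p _)
    _ = (∑ j, blkY s j + ∑ j, blkE s j) * (p + q) ^ k := by ring
    _ ≤ P.totalDegree * (p + q) ^ k := Nat.mul_le_mul_right _ (by omega)

/-- `|cf P d p q s| ≤ ((p : ℤ) + q) ^ d * |P.coeff s|`. -/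
theorem abs_cf_le (P : MvPolynomial (Fin (k + k + 1)) ℤ) {d p q : ℕ} {s : Fin (k + k + 1) →₀ ℕ}
    (hs : s 0 ≤ d) : |cf P d p q s| ≤ ((p : ℤ) + q) ^ d * |P.coeff s| := by
  unfold cf
  rw [abs_mul, abs_mul, abs_pow, abs_pow, Nat.abs_cast, Nat.abs_cast]
  have h1 : (p : ℤ) ^ (s 0) ≤ ((p : ℤ) + q) ^ (s 0) :=
    pow_le_pow_left₀ (by positivity) (by linarith [Int.natCast_nonneg q]) _
  have h2 : (q : ℤ) ^ (d - s 0) ≤ ((p : ℤ) + q) ^ (d - s 0) :=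
    pow_le_pow_left₀ (by positivity) (by linarith [Int.natCast_nonneg p]) _
  calc |P.coeff s| * (p : ℤ) ^ (s 0) * (q : ℤ) ^ (d - s 0)
      ≤ |P.coeff s| * ((p : ℤ) + q) ^ (s 0) * ((p : ℤ) + q) ^ (d - s 0) := by gcongr
    _ = ((p : ℤ) + q) ^ d * |P.coeff s| := by
        rw [mul_assoc, ← pow_add, Nat.add_sub_cancel' hs]; ring

/-- (E3b) length of the collapsed polynomial -/
theorem zlen_Apoly_le (P : MvPolynomial (Fin (k + k + 1)) ℤ) {d p q : ℕ}
    (hd : ∀ s ∈ P.support, s 0 ≤ d) :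
    zlen (Apoly P d p q) ≤ ((p : ℝ) + q) ^ d * zlen P := by
  unfold Apoly
  refine (zlen_sum_le _ _).trans ?_
  rw [zlen, Finset.mul_sum]
  refine Finset.sum_le_sum fun s hs => (zlen_monomial_le _ _).trans ?_
  have := abs_cf_le P (p := p) (q := q) (hd s hs)
  have h' : ((|cf P d p q s| : ℤ) : ℝ) ≤ ((((p : ℤ) + q) ^ d * |P.coeff s| : ℤ) : ℝ) := by
    exact_mod_cast this
  push_cast at h'
  exact h'

/-- the fibre polynomial of `t`: `Σ_{s : blocks(s) = blocks(t)} coeff(s) X^{s 0} ∈ ℤ[X]` -/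
def fib (P : MvPolynomial (Fin (k + k + 1)) ℤ) (t : Fin (k + k + 1) →₀ ℕ) : ℤ[X] :=
  ∑ s ∈ P.support with (blkY s = blkY t ∧ blkE s = blkE t), Polynomial.C (P.coeff s) * X ^ (s 0)

/-- `fib P t ≠ 0`. -/
theorem fib_ne_zero (P : MvPolynomial (Fin (k + k + 1)) ℤ) {t : Fin (k + k + 1) →₀ ℕ}
    (ht : t ∈ P.support) : fib P t ≠ 0 := by
  intro h0
  have hc : (fib P t).coeff (t 0) = P.coeff t := by
    unfold fib
    rw [Polynomial.finsetSum_coeff]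
    simp only [Polynomial.coeff_C_mul_X_pow]
    rw [Finset.sum_eq_single t]
    · rw [if_pos rfl]
    · intro s hs hst
      rw [if_neg]
      intro h00
      obtain ⟨_, hb⟩ := Finset.mem_filter.mp hs
      exact hst (eq_of_blocks h00.symm hb.1 hb.2)
    · intro h
      exact absurd (Finset.mem_filter.mpr ⟨ht, rfl, rfl⟩) h
  rw [h0, Polynomial.coeff_zero] at hc
  exact (MvPolynomial.mem_support_iff.mp ht) hc.symm

/-- value of the fibre polynomial, scaled: `q^d · fib(p/q) = Σ_{fibre} cf(s)` -/
theorem fib_eval_scaled (P : MvPolynomial (Fin (k + k + 1)) ℤ) {d p q : ℕ}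
    (hd : ∀ s ∈ P.support, s 0 ≤ d) (hq : q ≠ 0) (t : Fin (k + k + 1) →₀ ℕ) :
    (q : ℂ) ^ d * (Polynomial.map (Int.castRingHom ℂ) (fib P t)).eval ((p : ℂ) / q) =
      ((∑ s ∈ P.support with (blkY s = blkY t ∧ blkE s = blkE t), cf P d p q s : ℤ) : ℂ) := by
  have hqC : (q : ℂ) ≠ 0 := by exact_mod_cast hq
  unfold fib
  rw [Polynomial.map_sum, Polynomial.eval_finsetSum, Finset.mul_sum, Int.cast_sum]
  refine Finset.sum_congr rfl fun s hs => ?_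
  have hs0 : s 0 ≤ d := hd s (Finset.mem_filter.mp hs).1
  rw [Polynomial.map_mul, Polynomial.map_pow, Polynomial.map_X, Polynomial.map_C,
    Polynomial.eval_mul, Polynomial.eval_C, Polynomial.eval_pow, Polynomial.eval_X]
  simp only [cf, eq_intCast, Int.cast_mul, Int.cast_pow, Int.cast_natCast]
  rw [show (q : ℂ) ^ d = (q : ℂ) ^ (s 0) * (q : ℂ) ^ (d - s 0) by
    rw [← pow_add, Nat.add_sub_cancel' hs0], div_pow]
  field_simp

/-- (E2) the collapsed polynomial is non-zero when `p/q` avoids the roots of `collPoly` and of one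
fibre polynomial. -/
theorem Apoly_ne_zero (P : MvPolynomial (Fin (k + k + 1)) ℤ) {d p q : ℕ}
    (hd : ∀ s ∈ P.support, s 0 ≤ d) (hdeg : ∀ s ∈ P.support, ∀ i, s i ≤ d) (hq : q ≠ 0)
    (hcoll : (collPoly k d).eval ((p : ℂ) / q) ≠ 0) {t : Fin (k + k + 1) →₀ ℕ} (ht : t ∈ P.support)
    (hfib : (Polynomial.map (Int.castRingHom ℂ) (fib P t)).eval ((p : ℂ) / q) ≠ 0) :
    Apoly P d p q ≠ 0 := by
  have hqC : (q : ℂ) ≠ 0 := by exact_mod_cast hq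
  -- the coefficient of `A` at `key t`
  have hcoeff : (Apoly P d p q).coeff (key k q p t) =
      ∑ s ∈ P.support with (blkY s = blkY t ∧ blkE s = blkE t), cf P d p q s := by
    unfold Apoly
    rw [MvPolynomial.coeff_sum, Finset.sum_filter]
    refine Finset.sum_congr rfl fun s hs => ?_
    rw [MvPolynomial.coeff_monomial]
    by_cases hb : blkY s = blkY t ∧ blkE s = blkE t
    · rw [if_pos hb, if_pos]
      simp only [key, hb.1, hb.2]
    · rw [if_neg hb, if_neg]
      intro hk
      apply hb
      obtain ⟨h1, h2⟩ := fs2_inj hk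
      have hbd : ∀ (s : Fin (k + k + 1) →₀ ℕ), s ∈ P.support → (∀ j, blkY s j ≤ d) ∧ ∀ j, blkE s j ≤ d :=
        fun s hs => ⟨fun j => hdeg s hs _, fun j => hdeg s hs _⟩
      exact ⟨wt_inj hq hcoll (hbd s hs).1 (hbd t ht).1 h1, wt_inj hq hcoll (hbd s hs).2 (hbd t ht).2 h2⟩
  intro hA
  rw [hA, MvPolynomial.coeff_zero] at hcoeff
  have h := fib_eval_scaled P hd hq t (p := p)
  rw [← hcoeff, Int.cast_zero] at h
  rcases mul_eq_zero.mp h with h1 | h1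
  · exact pow_ne_zero _ hqC h1
  · exact hfib h1

/-! ### the smooth function `x ↦ P(lwPt(x))` on the real line -/

/-- `x ↦ P(x, e^{x^j}, e^{βx^j})` as an explicit sum (for differentiability) -/
def FL (P : MvPolynomial (Fin (k + k + 1)) ℤ) (β : ℂ) (x : ℝ) : ℂ :=
  ∑ s ∈ P.support, ((P.coeff s : ℤ) : ℂ) * ((x : ℂ) ^ (s 0) *
    cexp (∑ j : Fin k, (blkY s j : ℂ) * (x : ℂ) ^ ((j : ℕ) + 1) +
      ∑ j : Fin k, (blkE s j : ℂ) * (β * (x : ℂ) ^ ((j : ℕ) + 1))))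

/-- `FL P β x = MvPolynomial.aeval (lwPt k β (x : ℂ)) P` (for `(P : MvPolynomial (Fin (k + k + 1)) ℤ) (β : ℂ) (x : ℝ)`). -/
theorem FL_eq (P : MvPolynomial (Fin (k + k + 1)) ℤ) (β : ℂ) (x : ℝ) :
    FL P β x = MvPolynomial.aeval (lwPt k β (x : ℂ)) P := by
  rw [aeval_lwPt_eq, FL]
  refine Finset.sum_congr rfl fun s _ => ?_
  rw [prod_pow_cexp, prod_pow_cexp, ← Complex.exp_add]

/-- `ContDiff ℝ 1 (FL P β)` (for `(P : MvPolynomial (Fin (k + k + 1)) ℤ) (β : ℂ)`). -/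
theorem contDiff_FL (P : MvPolynomial (Fin (k + k + 1)) ℤ) (β : ℂ) : ContDiff ℝ 1 (FL P β) := by
  unfold FL
  have hx : ContDiff ℝ 1 (fun x : ℝ => (x : ℂ)) := Complex.ofRealCLM.contDiff
  refine ContDiff.sum fun s _ => ?_
  refine contDiff_const.mul ((hx.pow _).mul (Complex.contDiff_exp.comp ?_))
  refine ContDiff.add (ContDiff.sum fun j _ => contDiff_const.mul (hx.pow _))
    (ContDiff.sum fun j _ => contDiff_const.mul (contDiff_const.mul (hx.pow _)))

/-- `∃ Kl δ₁ : ℝ, 0 ≤ Kl ∧ 0 < δ₁ ∧ ∀ x : ℝ, |x - ℓ| < δ₁ → ‖FL P β x - FL P β ℓ‖ ≤ Kl * |x - ℓ|` (for `(P : MvPolynomial (Fin (k + k + 1)) ℤ) (β : ℂ) (ℓ : ℝ)`). -/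
theorem exists_lipschitz_FL (P : MvPolynomial (Fin (k + k + 1)) ℤ) (β : ℂ) (ℓ : ℝ) :
    ∃ Kl δ₁ : ℝ, 0 ≤ Kl ∧ 0 < δ₁ ∧ ∀ x : ℝ, |x - ℓ| < δ₁ → ‖FL P β x - FL P β ℓ‖ ≤ Kl * |x - ℓ| := by
  obtain ⟨K, t, ht, hK⟩ := ((contDiff_FL P β).contDiffAt (x := ℓ)).exists_lipschitzOnWith
  obtain ⟨δ₁, hδ₁, hball⟩ := Metric.mem_nhds_iff.mp ht
  refine ⟨K, δ₁, K.2, hδ₁, fun x hx => ?_⟩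
  have hxt : x ∈ t := hball (by rw [Metric.mem_ball, Real.dist_eq]; exact hx)
  have hℓt : ℓ ∈ t := hball (Metric.mem_ball_self hδ₁)
  have := (lipschitzOnWith_iff_dist_le_mul.mp hK) x hxt ℓ hℓt
  rwa [dist_eq_norm, Real.dist_eq] at this

end Summit.Schanuel.Schanuel.Theorems.RootDecomp1ELWTransport

end
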